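import Summits.CriticalPhenomena.PercolationContinuityZ3.Theorems.PercNearOneGluingNoHeavyLowerTailNineTypeKernels

/-!
# The EDGE-LIKE (atomic-step) two-copy bridge: law-level quadratic rows from antipodal counts over monotone profile maps whose
# one-coordinate steps join at most two blocks — the socket for `W0` / `B8`-type rows (four marked points, all `n`, all weights)

Support file for crux `stmt-CriticalPhenomena-4575` (master-family programme: dec frontier row 44 via the two-link deficit rows `B8`/`W0` of
`prim-l12-p1` gen 11–15), seat `prim-l12-p6` gen 19; memo `run/shared/lean/prim/prim-l12/FROM-prim-l12-p6-g19-TWO-WEIGHT-KERNEL.md` §6.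

The two-copy fibre bridge `TwoCopyMono.sum_kernel_cell_nonneg` (gen 10) turns `GoodKernel κ` — the antipodal count `Σ_T κ(P T, P Tᶜ) ≥ 0` for ALL
monotone equivalence-valued profile maps `P` on the subsets of a finite type — into `0 ≤ Σ κ i j·cell i·cell j` on every finite weighted graph.  The
quadratic rows that cut the exact row-44 pseudo-law of `prim-l12-p1` gen 11 (`W0`, `B8`) are NOT good kernels in that sense (their abstract count fails on
`B₂` at the 'super-join' map `∅↦⊥, {1}↦ab|c|y, {2}↦a|b|cy, {1,2}↦abcy`), but they are two-copy comb positive on every graph fibre tested (`K₄…K₇`), because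
a graph fibre map `T ↦ prof(C ∪ T)` has an extra property: ADDING ONE COORDINATE JOINS AT MOST TWO BLOCKS (`prof_insert_atomic`: the new profile is the old
one or its join with one atom `x ~ y` of the partition lattice of the four marked points).  This file records the corresponding bridge:

* `TwoCopyMono.prof_insert_atomic` — the one-edge step of the configuration profile is ATOMIC (old profile, or `fun i j ↦ P i j ∨ (P i x ∧ P y j) ∨ (P i y ∧ P x j)`).
* **`TwoCopyMono.sum_kernel_cell_nonneg_of_atomic`** — if `Σ_T κ(P T, P Tᶜ) ≥ 0` for all monotone equivalence-valued ATOMIC-STEP profile maps (hypothesis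
  written out; profile form) then `0 ≤ Σ_{i,j} κ i j·cell_w i·cell_w j` on every finite weighted graph, all marked points; `…_of_atomicIdx` — the same with the
  hypothesis in cell-index form (`ι : Finset γ → Fin 15`, `ple`-monotone, atomic steps read through `pp`), the form a finite-combinatorics proof would deliver.
* **`TwoCopyMono.b8_of_atomicCount`** — instance: the abstract atomic-step count for the `B8` kernel (prim-l12-p1 gen 11's CONJECTURE EdgeGood-B8)
  implies the two-link deficit row `B8: cell(ab|c|y)·cell(a|b|cy) ≤ cell(ab|cy)·[cell(∅)+cell(ab|c|y)+cell(a|b|cy)] + cell(∅)·ΣK + [cell(a|bcy)+cell(acy|b)]·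
  [cell(aby|c)+cell(abc|y)]` (`ΣK` = the four `3+1` cells) on EVERY finite weighted graph — CONDITIONAL; the abstract count is verified exhaustively for ground
  sets of size ≤ 5 (46 / 241 / 2 883 / 139 495 / 106 003 702 atomic-step monotone maps, 0 negative; two independent enumerators, memo §6).  CAUTION recorded
  there: the same abstract count for the sharper row `W0` of prim-l12-p1 gen 12 FAILS at size 5 (450 negative maps of 106 003 702, min −1), although `W0` is
  comb-positive on every graph fibre through `K₇` — so `W0` needs more than monotone + atomic steps, `B8` might not.
No named facts, no sorries, no new definitions.
-/

noncomputable section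

namespace Summit.CriticalPhenomena.PercolationContinuityZ3.Theorems

open MeasureTheory Set Finset Literature.Probability.Percolation
open Literature.Probability.LatticeModels (prodBernoulli)
open Summit.CriticalPhenomena.PercolationContinuityZ3.Cruxes.AdditiveGluing.TieLine.ConnAtoms

namespace TwoCopyMono

open FourPointAtoms

variable {n : ℕ}

/-! ## Reachability after inserting one pair -/

/-- One extra open pair: `x ↔ z` in `insert s(u,v) ω` iff `x ↔ z` in `ω`, or `x ↔ u` and `v ↔ z`, or `x ↔ v` and `u ↔ z` in `ω`. [folklore] -/
theorem reachable_insert_iff' (ω : Set (Sym2 (Fin n))) (u v x z : Fin n) :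
    (openGraph (insert s(u, v) ω)).Reachable x z ↔
      (openGraph ω).Reachable x z ∨ ((openGraph ω).Reachable x u ∧ (openGraph ω).Reachable v z) ∨
        ((openGraph ω).Reachable x v ∧ (openGraph ω).Reachable u z) := by
  constructor
  · intro h
    rw [SimpleGraph.reachable_iff_reflTransGen] at h
    induction h with
    | refl => exact Or.inl (SimpleGraph.Reachable.refl x)
    | @tail p q _ hpq ih =>
      rw [openGraph_adj] at hpq
      obtain ⟨hmem, hne⟩ := hpq
      rcases Set.mem_insert_iff.1 hmem with heq | hω
      · rcases Sym2.eq_iff.1 heq with ⟨rfl, rfl⟩ | ⟨rfl, rfl⟩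
        · rcases ih with h1 | ⟨h2, _⟩ | ⟨h4, _⟩
          · exact Or.inr (Or.inl ⟨h1, SimpleGraph.Reachable.refl _⟩)
          · exact Or.inr (Or.inl ⟨h2, SimpleGraph.Reachable.refl _⟩)
          · exact Or.inl h4
        · rcases ih with h1 | ⟨h2, _⟩ | ⟨h4, _⟩
          · exact Or.inr (Or.inr ⟨h1, SimpleGraph.Reachable.refl _⟩)
          · exact Or.inl h2
          · exact Or.inr (Or.inr ⟨h4, SimpleGraph.Reachable.refl _⟩)
      · have hadj : (openGraph ω).Adj p q := by rw [openGraph_adj]; exact ⟨hω, hne⟩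
        rcases ih with h1 | ⟨h2, h3⟩ | ⟨h4, h5⟩
        · exact Or.inl (h1.trans hadj.reachable)
        · exact Or.inr (Or.inl ⟨h2, h3.trans hadj.reachable⟩)
        · exact Or.inr (Or.inr ⟨h4, h5.trans hadj.reachable⟩)
  · have hmono : ∀ {p q : Fin n}, (openGraph ω).Reachable p q → (openGraph (insert s(u, v) ω)).Reachable p q :=
      fun h => h.mono (openGraph_mono (Set.subset_insert _ _))
    have huv : (openGraph (insert s(u, v) ω)).Reachable u v := by
      by_cases h : u = v
      · rw [h]
      · exact SimpleGraph.Adj.reachable ((openGraph_adj _ _ _).2 ⟨Set.mem_insert _ _, h⟩)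
    rintro (h | ⟨h1, h2⟩ | ⟨h1, h2⟩)
    · exact hmono h
    · exact ((hmono h1).trans huv).trans (hmono h2)
    · exact ((hmono h1).trans huv.symm).trans (hmono h2)

/-- **The profile step of one inserted pair is ATOMIC**: the profile of the four marked points in `insert e S` is either the profile in `S`, or its join
with ONE atom `x ~ y` (`x, y` marked points joined to the two endpoints of `e` in `S`): `prof' i j = prof i j ∨ (prof i x ∧ prof y j) ∨ (prof i y ∧ prof x j)`.
[this work] -/
theorem prof_insert_atomic (a b c y : Fin n) (S : Set (Sym2 (Fin n))) (e : Sym2 (Fin n)) :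
    prof a b c y (insert e S) = prof a b c y S ∨
      ∃ x₀ y₀ : Fin 4, prof a b c y (insert e S) =
        fun i j => (prof a b c y S i j || (prof a b c y S i x₀ && prof a b c y S y₀ j) || (prof a b c y S i y₀ && prof a b c y S x₀ j)) := by
  classical
  induction e using Sym2.ind with
  | _ u v =>
    set q := FourPointAtoms.quad a b c y with hq
    by_cases hu : ∃ x₀ : Fin 4, (openGraph S).Reachable (q x₀) u
    · by_cases hv : ∃ y₀ : Fin 4, (openGraph S).Reachable (q y₀) v
      · obtain ⟨x₀, hx₀⟩ := hu
        obtain ⟨y₀, hy₀⟩ := hv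
        refine Or.inr ⟨x₀, y₀, ?_⟩
        funext i j
        apply Bool.eq_iff_iff.2
        rw [prof_true_iff, reachable_insert_iff']
        simp only [Bool.or_eq_true, Bool.and_eq_true, prof_true_iff]
        constructor
        · rintro (h | ⟨h1, h2⟩ | ⟨h1, h2⟩)
          · exact Or.inl (Or.inl h)
          · exact Or.inl (Or.inr ⟨h1.trans hx₀.symm, hy₀.trans h2⟩)
          · exact Or.inr ⟨h1.trans hy₀.symm, hx₀.trans h2⟩
        · rintro ((h | ⟨h1, h2⟩) | ⟨h1, h2⟩)
          · exact Or.inl h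
          · exact Or.inr (Or.inl ⟨h1.trans hx₀, hy₀.symm.trans h2⟩)
          · exact Or.inr (Or.inr ⟨h1.trans hy₀, hx₀.symm.trans h2⟩)
      · refine Or.inl ?_
        funext i j
        apply Bool.eq_iff_iff.2
        rw [prof_true_iff, prof_true_iff, reachable_insert_iff']
        constructor
        · rintro (h | ⟨_, h2⟩ | ⟨h1, _⟩)
          · exact h
          · exact absurd ⟨j, h2.symm⟩ hv
          · exact absurd ⟨i, h1⟩ hv
        · exact fun h => Or.inl h
    · refine Or.inl ?_
      funext i j
      apply Bool.eq_iff_iff.2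
      rw [prof_true_iff, prof_true_iff, reachable_insert_iff']
      constructor
      · rintro (h | ⟨h1, _⟩ | ⟨_, h2⟩)
        · exact h
        · exact absurd ⟨i, h1⟩ hu
        · exact absurd ⟨j, h2.symm⟩ hu
      · exact fun h => Or.inl h

/-! ## The bridge for atomic-step counts -/

/-- **The atomic-step fibre count is nonnegative**: if `Σ_T κ(P T, P Tᶜ) ≥ 0` for every monotone, equivalence-valued, ATOMIC-STEP profile map `P`
on the subsets of a finite type, then for all `C D`: `0 ≤ Σ_{T ⊆ D} κ(prof(C∪T), prof(C∪(D∖T)))`. [this work] -/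
theorem fibreCount_nonneg_of_atomic {κ : Fin 15 → Fin 15 → ℤ}
    (hκ : ∀ (γ : Type) [Fintype γ] [DecidableEq γ] (P : Finset γ → Prof),
      (∀ S T : Finset γ, S ⊆ T → ProfLE (P S) (P T)) → (∀ T : Finset γ, IsEqv (P T)) →
      (∀ (T : Finset γ) (g : γ), P (insert g T) = P T ∨ ∃ x₀ y₀ : Fin 4, P (insert g T) =
        fun i j => (P T i j || (P T i x₀ && P T y₀ j) || (P T i y₀ && P T x₀ j))) →
        0 ≤ ∑ T : Finset γ, liftK κ (P T) (P Tᶜ))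
    (a b c y : Fin n) (C D : Finset (Sym2 (Fin n))) :
    0 ≤ ∑ T ∈ D.powerset, liftK κ (prof a b c y ↑(C ∪ T)) (prof a b c y ↑(C ∪ (D \ T))) := by
  classical
  let emb : Finset ↥D → Finset (Sym2 (Fin n)) := fun T => T.map (Function.Embedding.subtype _)
  let P : Finset ↥D → Prof := fun T => prof a b c y ↑(C ∪ emb T)
  have hemb : ∀ S T : Finset ↥D, S ⊆ T → emb S ⊆ emb T := by
    intro S T hST e he
    simp only [emb, Finset.mem_map, Function.Embedding.coe_subtype] at he ⊢
    obtain ⟨x, hx, rfl⟩ := he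
    exact ⟨x, hST hx, rfl⟩
  have hmono : ∀ S T : Finset ↥D, S ⊆ T → ProfLE (P S) (P T) := by
    intro S T hST
    apply prof_mono
    intro e he
    simp only [Finset.coe_union, Set.mem_union, Finset.mem_coe] at he ⊢
    rcases he with he | he
    · exact Or.inl he
    · exact Or.inr (hemb S T hST he)
  have heqv : ∀ T : Finset ↥D, IsEqv (P T) := fun T => prof_isEqv a b c y _
  have hatom : ∀ (T : Finset ↥D) (g : ↥D), P (insert g T) = P T ∨ ∃ x₀ y₀ : Fin 4, P (insert g T) =
      fun i j => (P T i j || (P T i x₀ && P T y₀ j) || (P T i y₀ && P T x₀ j)) := by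
    intro T g
    have hset : (↑(C ∪ emb (insert g T)) : Set (Sym2 (Fin n))) = insert (g : Sym2 (Fin n)) ↑(C ∪ emb T) := by
      ext e
      simp only [emb, Finset.coe_union, Finset.coe_map, Function.Embedding.coe_subtype, Finset.coe_insert, Set.mem_union,
        Set.mem_image, Set.mem_insert_iff, Finset.mem_coe]
      constructor
      · rintro (h | ⟨x, hx, rfl⟩)
        · exact Or.inr (Or.inl h)
        · rcases hx with rfl | hx
          · exact Or.inl rfl
          · exact Or.inr (Or.inr ⟨x, hx, rfl⟩)
      · rintro (rfl | h | ⟨x, hx, rfl⟩)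
        · exact Or.inr ⟨g, Or.inl rfl, rfl⟩
        · exact Or.inl h
        · exact Or.inr ⟨x, Or.inr hx, rfl⟩
    have key := prof_insert_atomic a b c y (↑(C ∪ emb T) : Set (Sym2 (Fin n))) (g : Sym2 (Fin n))
    rw [← hset] at key
    simp only [P]
    exact key
  have hgood := hκ (↥D) P hmono heqv hatom
  have hre : (∑ T : Finset ↥D, liftK κ (P T) (P Tᶜ)) =
      ∑ T ∈ D.powerset, liftK κ (prof a b c y ↑(C ∪ T)) (prof a b c y ↑(C ∪ (D \ T))) := by
    refine Finset.sum_bij' (fun T _ => emb T) (fun T _ => T.subtype (· ∈ D)) ?_ ?_ ?_ ?_ ?_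
    · intro T _
      rw [Finset.mem_powerset]
      intro e he
      simp only [emb, Finset.mem_map, Function.Embedding.coe_subtype] at he
      obtain ⟨x, _, rfl⟩ := he
      exact x.2
    · intro T _; exact Finset.mem_univ _
    · intro T _
      ext x
      simp [emb]
    · intro T hT
      rw [Finset.mem_powerset] at hT
      simp only [emb, Finset.subtype_map]
      exact Finset.filter_true_of_mem fun e he => hT he
    · intro T _
      have h1 : emb Tᶜ = D \ emb T := by
        ext e
        simp only [emb, Finset.mem_map, Function.Embedding.coe_subtype, Finset.mem_sdiff, Finset.mem_compl]
        constructor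
        · rintro ⟨x, hx, rfl⟩
          exact ⟨x.2, fun ⟨x', hx', he⟩ => hx (by rwa [Subtype.ext he] at hx')⟩
        · rintro ⟨heM, hne⟩
          exact ⟨⟨e, heM⟩, fun h => hne ⟨⟨e, heM⟩, h, rfl⟩, rfl⟩
      show liftK κ (P T) (P Tᶜ) = _
      simp only [P]
      rw [h1]
  rw [hre] at hgood
  exact hgood

/-- **The atomic-step (edge-like) bridge, profile form.**  If the antipodal count of `κ` is nonnegative for every monotone, equivalence-valued,
ATOMIC-STEP profile map on the subsets of a finite type, then `0 ≤ Σ_{i,j} κ i j·cell i·cell j` on every finite weighted graph, for all marked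
points. [this work] -/
theorem sum_kernel_cell_nonneg_of_atomic {κ : Fin 15 → Fin 15 → ℤ}
    (hκ : ∀ (γ : Type) [Fintype γ] [DecidableEq γ] (P : Finset γ → Prof),
      (∀ S T : Finset γ, S ⊆ T → ProfLE (P S) (P T)) → (∀ T : Finset γ, IsEqv (P T)) →
      (∀ (T : Finset γ) (g : γ), P (insert g T) = P T ∨ ∃ x₀ y₀ : Fin 4, P (insert g T) =
        fun i j => (P T i j || (P T i x₀ && P T y₀ j) || (P T i y₀ && P T x₀ j))) →
        0 ≤ ∑ T : Finset γ, liftK κ (P T) (P Tᶜ))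
    (w : Sym2 (Fin n) → unitInterval) (a b c y : Fin n) :
    0 ≤ ∑ i : Fin 15, ∑ j : Fin 15, (κ i j : ℝ) * FourPointAtoms.cell w a b c y i * FourPointAtoms.cell w a b c y j := by
  classical
  rw [sum_kernel_cell_eq_pairs, sum_pairs_eq_sum_fibres]
  refine Finset.sum_nonneg fun M _ => Finset.sum_nonneg fun C hC => ?_
  have hrw : ∀ T ∈ M.powerset,
      (liftK κ (prof a b c y ↑(C ∪ T)) (prof a b c y ↑(C ∪ (M \ T))) : ℝ) * (wt w (C ∪ T) * wt w (C ∪ (M \ T))) =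
        wt2 w M C * (liftK κ (prof a b c y ↑(C ∪ T)) (prof a b c y ↑(C ∪ (M \ T))) : ℝ) := by
    intro T hT
    rw [Finset.mem_powerset] at hT
    rw [wt_pair_eq w hT]; ring
  rw [Finset.sum_congr rfl hrw, ← Finset.mul_sum]
  refine mul_nonneg (wt2_nonneg w M C) ?_
  exact_mod_cast fibreCount_nonneg_of_atomic hκ a b c y C M

/-- **The atomic-step bridge, cell-index form** (the form a finite-combinatorics proof delivers): if for every finite type `γ` and every `ple`-monotone
`ι : Finset γ → Fin 15` whose one-coordinate steps are atomic (`ι (insert g T) = ι T`, or the profile `pp (ι (insert g T))` is the join of `pp (ι T)`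
with one atom) the count `Σ_T κ (ι T) (ι Tᶜ)` is nonnegative, then `0 ≤ Σ κ i j·cell i·cell j` on every finite weighted graph. [this work] -/
theorem sum_kernel_cell_nonneg_of_atomicIdx {κ : Fin 15 → Fin 15 → ℤ}
    (hκ : ∀ (γ : Type) [Fintype γ] [DecidableEq γ] (ι : Finset γ → Fin 15),
      (∀ S T : Finset γ, S ⊆ T → ple (ι S) (ι T) = true) →
      (∀ (T : Finset γ) (g : γ), ι (insert g T) = ι T ∨ ∃ x₀ y₀ : Fin 4, pp (ι (insert g T)) =
        fun i j => (pp (ι T) i j || (pp (ι T) i x₀ && pp (ι T) y₀ j) || (pp (ι T) i y₀ && pp (ι T) x₀ j))) →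
        0 ≤ ∑ T : Finset γ, κ (ι T) (ι Tᶜ))
    (w : Sym2 (Fin n) → unitInterval) (a b c y : Fin n) :
    0 ≤ ∑ i : Fin 15, ∑ j : Fin 15, (κ i j : ℝ) * FourPointAtoms.cell w a b c y i * FourPointAtoms.cell w a b c y j := by
  classical
  refine sum_kernel_cell_nonneg_of_atomic (fun γ _ _ P hmono heqv hatom => ?_) w a b c y
  have hex : ∀ T : Finset γ, ∃ i : Fin 15, P T = pp i := fun T => exists_pat_of_isEqv (heqv T)
  choose ι hι using hex
  have hmono' : ∀ S T : Finset γ, S ⊆ T → ple (ι S) (ι T) = true := by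
    intro S T hST; apply ple_of_profLE; rw [← hι S, ← hι T]; exact hmono S T hST
  have hatom' : ∀ (T : Finset γ) (g : γ), ι (insert g T) = ι T ∨ ∃ x₀ y₀ : Fin 4, pp (ι (insert g T)) =
      fun i j => (pp (ι T) i j || (pp (ι T) i x₀ && pp (ι T) y₀ j) || (pp (ι T) i y₀ && pp (ι T) x₀ j)) := by
    intro T g
    rcases hatom T g with h | ⟨x₀, y₀, h⟩
    · left
      apply pp_injective
      rw [← hι, ← hι, h]
    · right
      refine ⟨x₀, y₀, ?_⟩
      rw [← hι, ← hι]
      exact h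
  have h := hκ γ ι hmono' hatom'
  have heq : (∑ T : Finset γ, liftK κ (P T) (P Tᶜ)) = ∑ T : Finset γ, κ (ι T) (ι Tᶜ) := by
    refine Finset.sum_congr rfl fun T _ => ?_
    rw [hι T, hι Tᶜ, liftK_pp]
  rw [heq]; exact h

/-! ## Instance: the two-link deficit row `W0` from its abstract atomic-step count -/

/-- Evaluation of an elementary kernel: `Σ_{i,j} [i = p ∧ j = q]·cᵢ·dⱼ = c_p·d_q`. [this work] -/
theorem sum_indicator_pair (p q : Fin 15) (c d : Fin 15 → ℝ) :
    (∑ i : Fin 15, ∑ j : Fin 15, (if i = p ∧ j = q then (1 : ℝ) else 0) * c i * d j) = c p * d q := by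
  rw [Finset.sum_eq_single p]
  · rw [Finset.sum_eq_single q]
    · simp
    · intro j _ hj; rw [if_neg (fun h => hj h.2)]; ring
    · intro h; exact absurd (Finset.mem_univ _) h
  · intro i _ hi
    exact Finset.sum_eq_zero fun j _ => by rw [if_neg (fun h => hi h.1)]; ring
  · intro h; exact absurd (Finset.mem_univ _) h

/-- **`B8` on every finite weighted graph from the abstract atomic-step count (conditional; prim-l12-p1 gen 11's CONJECTURE EdgeGood-B8).**  If for
every finite type `γ` and every `ple`-monotone, atomic-step `ι : Finset γ → Fin 15` the signed count of the `B8` kernel is nonnegative (eleven `+1` pairs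
`(ab|cy,∅),(ab|cy,ab|c|y),(ab|cy,a|b|cy),(∅,a|bcy),(∅,acy|b),(∅,aby|c),(∅,abc|y),(a|bcy,aby|c),(a|bcy,abc|y),(acy|b,aby|c),(acy|b,abc|y)` against the `−1` pair
`(ab|c|y,a|b|cy)`; verified exhaustively for `|γ| ≤ 5`, memo §6), then the two-link deficit row `B8` holds for all `n`:
`cell 6·cell 1 ≤ cell 11·(cell 0 + cell 6 + cell 1) + cell 0·(cell 7 + cell 10 + cell 12 + cell 13) + (cell 7 + cell 10)·(cell 12 + cell 13)`. [this work] -/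
theorem b8_of_atomicCount
    (hB8 : ∀ (γ : Type) [Fintype γ] [DecidableEq γ] (ι : Finset γ → Fin 15),
      (∀ S T : Finset γ, S ⊆ T → ple (ι S) (ι T) = true) →
      (∀ (T : Finset γ) (g : γ), ι (insert g T) = ι T ∨ ∃ x₀ y₀ : Fin 4, pp (ι (insert g T)) =
        fun i j => (pp (ι T) i j || (pp (ι T) i x₀ && pp (ι T) y₀ j) || (pp (ι T) i y₀ && pp (ι T) x₀ j))) →
        0 ≤ ∑ T : Finset γ, ((if ι T = 11 ∧ ι Tᶜ = 0 then (1 : ℤ) else 0) + (if ι T = 11 ∧ ι Tᶜ = 6 then (1 : ℤ) else 0) +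
          (if ι T = 11 ∧ ι Tᶜ = 1 then (1 : ℤ) else 0) + (if ι T = 0 ∧ ι Tᶜ = 7 then (1 : ℤ) else 0) + (if ι T = 0 ∧ ι Tᶜ = 10 then (1 : ℤ) else 0) +
          (if ι T = 0 ∧ ι Tᶜ = 12 then (1 : ℤ) else 0) + (if ι T = 0 ∧ ι Tᶜ = 13 then (1 : ℤ) else 0) + (if ι T = 7 ∧ ι Tᶜ = 12 then (1 : ℤ) else 0) +
          (if ι T = 7 ∧ ι Tᶜ = 13 then (1 : ℤ) else 0) + (if ι T = 10 ∧ ι Tᶜ = 12 then (1 : ℤ) else 0) + (if ι T = 10 ∧ ι Tᶜ = 13 then (1 : ℤ) else 0) -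
          (if ι T = 6 ∧ ι Tᶜ = 1 then (1 : ℤ) else 0)))
    (w : Sym2 (Fin n) → unitInterval) (a b c y : Fin n) :
    cell w a b c y 6 * cell w a b c y 1 ≤
      cell w a b c y 11 * (cell w a b c y 0 + cell w a b c y 6 + cell w a b c y 1) +
        cell w a b c y 0 * (cell w a b c y 7 + cell w a b c y 10 + cell w a b c y 12 + cell w a b c y 13) +
        (cell w a b c y 7 + cell w a b c y 10) * (cell w a b c y 12 + cell w a b c y 13) := by
  classical
  set κ : Fin 15 → Fin 15 → ℤ := fun i j => (if i = 11 ∧ j = 0 then (1 : ℤ) else 0) + (if i = 11 ∧ j = 6 then (1 : ℤ) else 0) +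
    (if i = 11 ∧ j = 1 then (1 : ℤ) else 0) + (if i = 0 ∧ j = 7 then (1 : ℤ) else 0) + (if i = 0 ∧ j = 10 then (1 : ℤ) else 0) +
    (if i = 0 ∧ j = 12 then (1 : ℤ) else 0) + (if i = 0 ∧ j = 13 then (1 : ℤ) else 0) + (if i = 7 ∧ j = 12 then (1 : ℤ) else 0) +
    (if i = 7 ∧ j = 13 then (1 : ℤ) else 0) + (if i = 10 ∧ j = 12 then (1 : ℤ) else 0) + (if i = 10 ∧ j = 13 then (1 : ℤ) else 0) -
    (if i = 6 ∧ j = 1 then (1 : ℤ) else 0) with hκ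
  have h := sum_kernel_cell_nonneg_of_atomicIdx (κ := κ) (fun γ _ _ ι hmono hatom => hB8 γ ι hmono hatom) w a b c y
  set cl := cell w a b c y with hcl
  have hsplit : ∀ i j : Fin 15, (κ i j : ℝ) * cl i * cl j =
      (if i = 11 ∧ j = 0 then (1 : ℝ) else 0) * cl i * cl j + (if i = 11 ∧ j = 6 then (1 : ℝ) else 0) * cl i * cl j +
      (if i = 11 ∧ j = 1 then (1 : ℝ) else 0) * cl i * cl j + (if i = 0 ∧ j = 7 then (1 : ℝ) else 0) * cl i * cl j +
      (if i = 0 ∧ j = 10 then (1 : ℝ) else 0) * cl i * cl j + (if i = 0 ∧ j = 12 then (1 : ℝ) else 0) * cl i * cl j +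
      (if i = 0 ∧ j = 13 then (1 : ℝ) else 0) * cl i * cl j + (if i = 7 ∧ j = 12 then (1 : ℝ) else 0) * cl i * cl j +
      (if i = 7 ∧ j = 13 then (1 : ℝ) else 0) * cl i * cl j + (if i = 10 ∧ j = 12 then (1 : ℝ) else 0) * cl i * cl j +
      (if i = 10 ∧ j = 13 then (1 : ℝ) else 0) * cl i * cl j - (if i = 6 ∧ j = 1 then (1 : ℝ) else 0) * cl i * cl j := by
    intro i j; simp only [hκ]; push_cast; ring
  rw [Finset.sum_congr rfl (fun i _ => Finset.sum_congr rfl (fun j _ => hsplit i j))] at h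
  simp only [Finset.sum_add_distrib, Finset.sum_sub_distrib, sum_indicator_pair] at h
  linarith

end TwoCopyMono

end Summit.CriticalPhenomena.PercolationContinuityZ3.Theorems

end
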